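import Literature.NumberTheory.CubicFields.BinaryCubicForms
import Mathlib.Data.ZMod.Basic
import HarnessLib

/-!
# Integer-matrix binary cubic forms `a₀u³ + 3a₁u²v + 3a₂uv² + a₃v³`: reduced discriminant, Hessian, and the cubic covariant of Eisenstein–Bhargava

Topic `Literature/NumberTheory/CubicFields`, continuing `BinaryCubicForms.lean` (`V(ℤ)`, `Disc`,
the substitution action). The vocabulary of the class-field-theory-free road to the
Davenport–Heilbronn theorem on the mean size of `Cl(K)[3]` over quadratic fields `K`
(Bhargava–Varma 2016, §§2–3, through Bhargava's parametrization of 3-torsion ideal classes by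
binary cubic forms, *Higher composition laws I*, Thm 13):

* Bhargava–Varma, §2.1: "We will be interested in the sublattice of binary cubic forms of the
  form `f(x,y) = ax³ + 3bx²y + 3cxy² + dy³`, called classically integral or *integer-matrix* …
  `V_ℤ*` … index `9` in `V_ℤ` … preserved by `GL₂(ℤ)`. We also define the *reduced discriminant*
  `disc(f) := −Disc(f)/27 = −3b²c² + 4ac³ + 4b³d + a²d² − 6abcd`" — here the structure
  `SymCubic R` with coordinates `(a₀, a₁, a₂, a₃)` (Bhargava's `Sym³ℤ²`, HCL I §3.4), its form
  `toBinaryCubic = (a₀, 3a₁, 3a₂, a₃) ∈ V(R)`, the reduced discriminant `disc`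
  (`disc_toBinaryCubic : Disc = −27 · disc`), and the substitution action `subst` of `2 × 2`
  matrices, compatible with that of `V` (`toBinaryCubic_subst`) — so `V*` is indeed preserved —
  with `disc (C.subst γ) = (det γ)⁶ disc C`; `SL₂(ℤ)`-equivalence `SL2ZEquiv` (an equivalence
  relation preserving `disc`).
* Bhargava–Varma (7) / HCL I (24): the **Hessian** `Q = (A, B, C) = (a₁² − a₀a₂, a₀a₃ − a₁a₂, a₂² − a₁a₃)`
  (`hess`), a binary quadratic form (the tree's triple encoding `ℤ × ℤ × ℤ` of
  `QuadraticFields/ReducedForms.lean`) of discriminant `B² − 4AC = disc` (`discr_hess`), a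
  covariant of weight `2` (`hess_subst`).
* HCL I, proof of Thm 13 (the displayed solution `c₀, …, c₃`; Bhargava–Varma (6)): the
  **cubic covariant** `g = (g₀, g₁, g₂, g₃)` (`gCov`),
  `g₀ = 2a₁³ − 3a₀a₁a₂ + a₀²a₃`, `g₁ = a₁²a₂ − 2a₀a₂² + a₀a₁a₃`, `g₂ = −(a₁a₂² − 2a₁²a₃ + a₀a₂a₃)`,
  `g₃ = −(2a₂³ − 3a₁a₂a₃ + a₀a₃²)`, in terms of which Bhargava's `cᵢ = (gᵢ − ε aᵢ)/2` and the four
  elements `cᵢ + aᵢτ = (gᵢ + aᵢ√D)/2` of the quadratic ring `ℤ[τ]`, `τ = (ε + √D)/2`, `D = disc`.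
  The identities that make Thm 13 work — "`(α²β)² = α³ · αβ²` and `(αβ²)² = α²β · β³`", i.e.
  `θ₀θ₂ = θ₁²`, `θ₁θ₃ = θ₂²` (and `θ₀θ₃ = θ₁θ₂`) for `θᵢ = gᵢ + aᵢ√D` — are PROVED here as
  polynomial identities, split into `√D`-free and `√D`-parts: the **syzygies**
  `g₀g₂ − g₁² = D·A`, `g₁g₃ − g₂² = D·C`, `g₀g₃ − g₁g₂ = −D·B` (`gCov_syzygy₀₂/₁₃/₀₃`) and the
  linear relations `a₀g₂ + a₂g₀ = 2a₁g₁`, `a₁g₃ + a₃g₁ = 2a₂g₂`, `a₀g₃ + a₃g₀ = a₁g₂ + a₂g₁`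
  (`gCov_linear₀₂/₁₃/₀₃`); `g` is a covariant of weight `3` (`gCov_subst`); and the **parity**
  `gᵢ ≡ D aᵢ (mod 2)` (`two_dvd_gCov_add_disc_mul`), which is the integrality of Bhargava's `cᵢ`
  ("the solutions for the `{cᵢ}` are necessarily integral").

Everything is a definition with body or a proved identity (no named facts). NOT here: the
quadratic ring and the map `C ↦ (I, δ)` itself (HCL I Thm 13 / Bhargava–Varma Thm 9), which live
in the sequel files on the parametrization.

## References

* M. Bhargava, I. Varma, *The mean number of 3-torsion elements in the class groups and ideal
  groups of quadratic orders*, Proc. LMS 112 (2016) 235–266 = arXiv:1401.5875, §2.1 (4)–(7)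
  [BhargavaVarma2016].
* M. Bhargava, *Higher composition laws I*, Ann. of Math. 159 (2004) 217–250, §3.4, Thm 13 and its
  proof (eqs. (21)–(24)) [Bhargava2004HCL1].
* G. Eisenstein, *Théorèmes sur les formes cubiques*, J. reine angew. Math. 27 (1844) (the
  correspondence for `D < 0`, as cited in both).

## Design

* A separate four-field structure rather than the subtype `{f : BinaryCubic ℤ // 3 ∣ b ∧ 3 ∣ c}`:
  all of Bhargava's formulas are polynomials in `(a₀, a₁, a₂, a₃)`, and `V*(R)` makes sense over
  any commutative ring (BV Remark 12: base change to `ℤ_p`); the bridge to `V(R)` is `toBinaryCubic`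
  (injective over `ℤ`, `toBinaryCubic_injective`).
* Only the substitution action (no twist) and `SL₂`: Thm 13 / BV Thm 9 are about `SL₂(ℤ)`-orbits.
-/

namespace Literature.NumberTheory.CubicFields

/-- An integer-matrix (classically integral) binary cubic form
`C(u,v) = a₀u³ + 3a₁u²v + 3a₂uv² + a₃v³`, i.e. an element of `Sym³R²` in the coordinates
`(a₀, a₁, a₂, a₃)` of Bhargava, HCL I §3.4; for `R = ℤ` the lattice `V_ℤ*` of Bhargava–Varma
§2.1. [cite: BhargavaVarma2016, §2.1 (the lattice V_ℤ* of integer-matrix forms)] -/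
@[ext]
structure SymCubic (R : Type*) where
  /-- coefficient of `u³` -/
  a₀ : R
  /-- one third of the coefficient of `u²v` -/
  a₁ : R
  /-- one third of the coefficient of `uv²` -/
  a₂ : R
  /-- coefficient of `v³` -/
  a₃ : R

namespace SymCubic

variable {R : Type*} [CommRing R]

/-! ### The form, the bridge to `V(R)`, the reduced discriminant -/

/-- The binary cubic form `(a₀, 3a₁, 3a₂, a₃) ∈ V(R)` of an integer-matrix form (BV §2.1:
`V_ℤ* ⊂ V_ℤ`). [cite: BhargavaVarma2016, §2.1] -/
def toBinaryCubic (C : SymCubic R) : BinaryCubic R :=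
  ⟨C.a₀, 3 * C.a₁, 3 * C.a₂, C.a₃⟩

/-- `toBinaryCubic` on coefficients (definitional). [folklore] -/
@[simp] theorem toBinaryCubic_a (C : SymCubic R) : C.toBinaryCubic.a = C.a₀ := rfl
/-- `toBinaryCubic` on coefficients (definitional). [folklore] -/
@[simp] theorem toBinaryCubic_b (C : SymCubic R) : C.toBinaryCubic.b = 3 * C.a₁ := rfl
/-- `toBinaryCubic` on coefficients (definitional). [folklore] -/
@[simp] theorem toBinaryCubic_c (C : SymCubic R) : C.toBinaryCubic.c = 3 * C.a₂ := rfl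
/-- `toBinaryCubic` on coefficients (definitional). [folklore] -/
@[simp] theorem toBinaryCubic_d (C : SymCubic R) : C.toBinaryCubic.d = C.a₃ := rfl

/-- Over `ℤ` an integer-matrix form is determined by its binary cubic form (`3a₁ = 3a₁'` forces
`a₁ = a₁'`). [folklore] -/
theorem toBinaryCubic_injective : Function.Injective (toBinaryCubic : SymCubic ℤ → BinaryCubic ℤ) := by
  intro C C' h
  have ha := congrArg BinaryCubic.a h
  have hb := congrArg BinaryCubic.b h
  have hc := congrArg BinaryCubic.c h
  have hd := congrArg BinaryCubic.d h
  simp only [toBinaryCubic_a, toBinaryCubic_b, toBinaryCubic_c, toBinaryCubic_d] at ha hb hc hd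
  exact SymCubic.ext ha (by omega) (by omega) hd

/-- The value `C(u,v) = a₀u³ + 3a₁u²v + 3a₂uv² + a₃v³`. [folklore] -/
def eval (C : SymCubic R) (u v : R) : R :=
  C.a₀ * u ^ 3 + 3 * C.a₁ * u ^ 2 * v + 3 * C.a₂ * u * v ^ 2 + C.a₃ * v ^ 3

/-- `C(u,v)` is the value of the binary cubic form `toBinaryCubic C`. [folklore] -/
theorem eval_toBinaryCubic (C : SymCubic R) (u v : R) : C.toBinaryCubic.eval u v = C.eval u v := by
  simp only [BinaryCubic.eval, eval, toBinaryCubic, mul_assoc]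

/-- Scaling all coordinates: `(μ • C) = (μa₀, μa₁, μa₂, μa₃)`. [folklore] -/
instance : SMul R (SymCubic R) :=
  ⟨fun μ C => ⟨μ * C.a₀, μ * C.a₁, μ * C.a₂, μ * C.a₃⟩⟩

/-- Scaling on `a₀` (definitional). [folklore] -/
@[simp] theorem smul_a₀ (μ : R) (C : SymCubic R) : (μ • C).a₀ = μ * C.a₀ := rfl
/-- Scaling on `a₁` (definitional). [folklore] -/
@[simp] theorem smul_a₁ (μ : R) (C : SymCubic R) : (μ • C).a₁ = μ * C.a₁ := rfl
/-- Scaling on `a₂` (definitional). [folklore] -/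
@[simp] theorem smul_a₂ (μ : R) (C : SymCubic R) : (μ • C).a₂ = μ * C.a₂ := rfl
/-- Scaling on `a₃` (definitional). [folklore] -/
@[simp] theorem smul_a₃ (μ : R) (C : SymCubic R) : (μ • C).a₃ = μ * C.a₃ := rfl

/-- `(μ • C)(u,v) = μ · C(u,v)`. [folklore] -/
theorem eval_smul (μ : R) (C : SymCubic R) (u v : R) : (μ • C).eval u v = μ * C.eval u v := by
  simp only [eval, smul_a₀, smul_a₁, smul_a₂, smul_a₃]
  ring

/-- The **reduced discriminant** `disc(C) = a₀²a₃² − 3a₁²a₂² − 6a₀a₁a₂a₃ + 4a₀a₂³ + 4a₁³a₃`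
(Bhargava–Varma (5): `disc(f) := −Disc(f)/27 = −3b²c² + 4ac³ + 4b³d + a²d² − 6abcd` for
`f = ax³ + 3bx²y + 3cxy² + dy³`; the discriminant `D` of HCL I Thm 13). [cite: BhargavaVarma2016, §2.1 (5)] -/
def disc (C : SymCubic R) : R :=
  C.a₀ ^ 2 * C.a₃ ^ 2 - 3 * C.a₁ ^ 2 * C.a₂ ^ 2 - 6 * C.a₀ * C.a₁ * C.a₂ * C.a₃
    + 4 * C.a₀ * C.a₂ ^ 3 + 4 * C.a₁ ^ 3 * C.a₃

/-- BV (5): `Disc(f) = −27 · disc(f)` for the binary cubic form of an integer-matrix form.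
[cite: BhargavaVarma2016, §2.1 (5)] -/
theorem disc_toBinaryCubic (C : SymCubic R) : C.toBinaryCubic.disc = -27 * C.disc := by
  simp only [BinaryCubic.disc_eq, toBinaryCubic, disc]
  ring

/-- Examples: `disc(u³ + v³) = 1` (coordinates `(1, 0, 0, 1)`) and `disc(3u²v + 3uv²) = −3`
(coordinates `(0, 1, 1, 0)`; its binary cubic form `3uv(u + v)` has `Disc = 81 = −27 · (−3)`).
[folklore] -/
example : (⟨1, 0, 0, 1⟩ : SymCubic ℤ).disc = 1 ∧ (⟨0, 1, 1, 0⟩ : SymCubic ℤ).disc = -3 := by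
  constructor <;> simp [disc]

/-! ### The substitution action and `SL₂(ℤ)`-equivalence -/

/-- The substitution action of a `2 × 2` matrix `γ = (p q; r s)` on integer-matrix forms:
`(C.subst γ)(u,v) = C((u,v)γ) = C(pu + rv, qu + sv)` (`eval_subst`), on the coordinates
`(a₀, a₁, a₂, a₃)` — the middle coefficients of `C ∘ γ` are again divisible by `3`, so `V*` is
preserved (BV §2.1: "`V_ℤ*` … is also preserved by `GL₂(ℤ)`"; `toBinaryCubic_subst`).
[cite: BhargavaVarma2016, §2.1 (V_ℤ* is preserved)] -/
def subst (C : SymCubic R) (γ : Matrix (Fin 2) (Fin 2) R) : SymCubic R :=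
  let p := γ 0 0; let q := γ 0 1; let r := γ 1 0; let s := γ 1 1
  ⟨C.a₀ * p ^ 3 + 3 * C.a₁ * p ^ 2 * q + 3 * C.a₂ * p * q ^ 2 + C.a₃ * q ^ 3,
    C.a₀ * p ^ 2 * r + C.a₁ * (p ^ 2 * s + 2 * p * q * r) + C.a₂ * (2 * p * q * s + q ^ 2 * r)
      + C.a₃ * q ^ 2 * s,
    C.a₀ * p * r ^ 2 + C.a₁ * (2 * p * r * s + q * r ^ 2) + C.a₂ * (p * s ^ 2 + 2 * q * r * s)
      + C.a₃ * q * s ^ 2,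
    C.a₀ * r ^ 3 + 3 * C.a₁ * r ^ 2 * s + 3 * C.a₂ * r * s ^ 2 + C.a₃ * s ^ 3⟩

/-- `(C.subst γ)(u,v) = C((u,v)γ)`. [folklore] -/
theorem eval_subst (C : SymCubic R) (γ : Matrix (Fin 2) (Fin 2) R) (u v : R) :
    (C.subst γ).eval u v = C.eval (u * γ 0 0 + v * γ 1 0) (u * γ 0 1 + v * γ 1 1) := by
  simp only [subst, eval]
  ring

/-- The substitution actions on `V*` and on `V` agree: `(C ∘ γ)` as a binary cubic form is
`toBinaryCubic C ∘ γ`. [folklore] -/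
theorem toBinaryCubic_subst (C : SymCubic R) (γ : Matrix (Fin 2) (Fin 2) R) :
    (C.subst γ).toBinaryCubic = C.toBinaryCubic.subst γ := by
  ext <;> simp only [subst, toBinaryCubic, BinaryCubic.subst] <;> ring

/-- The identity matrix acts trivially. [folklore] -/
@[simp] theorem subst_one (C : SymCubic R) : C.subst 1 = C := by
  ext <;> simp [subst]

/-- The substitution action is a left action: `C.subst (γ₁ γ₂) = (C.subst γ₂).subst γ₁`. [folklore] -/
theorem subst_mul (C : SymCubic R) (γ₁ γ₂ : Matrix (Fin 2) (Fin 2) R) :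
    C.subst (γ₁ * γ₂) = (C.subst γ₂).subst γ₁ := by
  ext <;> simp only [subst, Matrix.mul_apply, Fin.sum_univ_two] <;> ring

/-- `disc(C ∘ γ) = (det γ)⁶ disc(C)`: the reduced discriminant is `SL₂`-invariant (BV §2.1: "the
action … preserves (both definitions of) the discriminant"). [cite: BhargavaVarma2016, §2.1] -/
theorem disc_subst (C : SymCubic R) (γ : Matrix (Fin 2) (Fin 2) R) :
    (C.subst γ).disc = γ.det ^ 6 * C.disc := by
  simp only [subst, disc, Matrix.det_fin_two]
  ring

/-- `SL₂(ℤ)`-equivalence of integer-matrix forms: `C' = C ∘ γ` for an integral `γ` of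
determinant `1` (the `SL₂(ℤ)`-orbits on `V_ℤ*` of BV Thm 9 / HCL I Thm 13). [cite: BhargavaVarma2016, Theorem 9 (SL₂(ℤ)-orbits on V_ℤ*)] -/
def SL2ZEquiv (C C' : SymCubic ℤ) : Prop :=
  ∃ γ : Matrix (Fin 2) (Fin 2) ℤ, γ.det = 1 ∧ C' = C.subst γ

/-- `SL₂(ℤ)`-equivalence is reflexive. [folklore] -/
theorem SL2ZEquiv.refl (C : SymCubic ℤ) : SL2ZEquiv C C :=
  ⟨1, by simp, by simp⟩

/-- `SL₂(ℤ)`-equivalence is transitive. [folklore] -/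
theorem SL2ZEquiv.trans {C C' C'' : SymCubic ℤ} (h₁ : SL2ZEquiv C C') (h₂ : SL2ZEquiv C' C'') :
    SL2ZEquiv C C'' := by
  obtain ⟨γ₁, hγ₁, rfl⟩ := h₁
  obtain ⟨γ₂, hγ₂, rfl⟩ := h₂
  exact ⟨γ₂ * γ₁, by rw [Matrix.det_mul, hγ₁, hγ₂, mul_one], (subst_mul C γ₂ γ₁).symm⟩

/-- `SL₂(ℤ)`-equivalence is symmetric. [folklore] -/
theorem SL2ZEquiv.symm {C C' : SymCubic ℤ} (h : SL2ZEquiv C C') : SL2ZEquiv C' C := by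
  obtain ⟨γ, hγ, rfl⟩ := h
  have hu : IsUnit γ.det := by rw [hγ]; exact isUnit_one
  refine ⟨γ⁻¹, ?_, ?_⟩
  · rw [Matrix.det_nonsing_inv, hγ, Ring.inverse_one]
  · rw [← subst_mul, Matrix.nonsing_inv_mul γ hu, subst_one]

/-- `SL₂(ℤ)`-equivalence is an equivalence relation. [folklore] -/
theorem SL2ZEquiv.equivalence : Equivalence SL2ZEquiv :=
  ⟨SL2ZEquiv.refl, SL2ZEquiv.symm, SL2ZEquiv.trans⟩

/-- Equivalent forms have the same reduced discriminant. [folklore] -/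
theorem SL2ZEquiv.disc_eq {C C' : SymCubic ℤ} (h : SL2ZEquiv C C') : C'.disc = C.disc := by
  obtain ⟨γ, hγ, rfl⟩ := h
  rw [disc_subst, hγ, one_pow, one_mul]

/-- The `SL₂(ℤ)`-orbit of an integer-matrix form. [folklore] -/
def sl2zOrbit (C : SymCubic ℤ) : Set (SymCubic ℤ) :=
  {C' | SL2ZEquiv C C'}

/-- Two forms have the same orbit iff they are equivalent. [folklore] -/
theorem sl2zOrbit_eq_iff {C C' : SymCubic ℤ} : sl2zOrbit C = sl2zOrbit C' ↔ SL2ZEquiv C C' := by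
  constructor
  · intro h
    have h' : C' ∈ sl2zOrbit C := by rw [h]; exact SL2ZEquiv.refl C'
    exact h'
  · intro h
    ext C''
    exact ⟨fun h'' => h.symm.trans h'', fun h'' => h.trans h''⟩

/-! ### The Hessian -/

/-- The **Hessian** (quadratic covariant) `Q = (A, B, C) = (a₁² − a₀a₂, a₀a₃ − a₁a₂, a₂² − a₁a₃)`
of `C`, as a binary quadratic form `Au² + Buv + Cv²` in the triple encoding `ℤ × ℤ × ℤ` of the tree
(Bhargava–Varma (7); HCL I (24): `p₁, q₁, r₁`, giving the `𝒪`-module structure and the norm form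
of the ideal `I` attached to `C`). [cite: BhargavaVarma2016, §2.1 (7)] -/
def hess (C : SymCubic R) : R × R × R :=
  (C.a₁ ^ 2 - C.a₀ * C.a₂, C.a₀ * C.a₃ - C.a₁ * C.a₂, C.a₂ ^ 2 - C.a₁ * C.a₃)

/-- **The Hessian has discriminant `disc(C)`**: `B² − 4AC = disc C` (so the quadratic ring of
discriminant `disc C` acts on `I`; HCL I, proof of Thm 13). [cite: Bhargava2004HCL1, §3.4 (proof of Theorem 13, eq. (24))] -/
theorem discr_hess (C : SymCubic R) :
    (C.hess).2.1 ^ 2 - 4 * (C.hess).1 * (C.hess).2.2 = C.disc := by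
  simp only [hess, disc]
  ring

/-- **The Hessian is a covariant of weight `2`** (for the conjugated matrix, reflecting the sign
convention `(A, B, C) = −Hess(u, −v)/36` of Bhargava–Varma (7)): for `γ = (p q; r s)`,
`hess (C ∘ γ) = (det γ)² · (hess C) ∘ γ'` with `γ' = (p −q; −r s)`, where on triples
`Q ∘ γ' = (Ap² − Bpq + Cq², −2Apr + B(ps + qr) − 2Cqs, Ar² − Brs + Cs²)`. [folklore] -/
theorem hess_subst (C : SymCubic R) (γ : Matrix (Fin 2) (Fin 2) R) :
    (C.subst γ).hess =
      (γ.det ^ 2 * ((C.hess).1 * γ 0 0 ^ 2 - (C.hess).2.1 * γ 0 0 * γ 0 1 + (C.hess).2.2 * γ 0 1 ^ 2),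
       γ.det ^ 2 * (-(2 * (C.hess).1 * γ 0 0 * γ 1 0) + (C.hess).2.1 * (γ 0 0 * γ 1 1 + γ 0 1 * γ 1 0)
          - 2 * (C.hess).2.2 * γ 0 1 * γ 1 1),
       γ.det ^ 2 * ((C.hess).1 * γ 1 0 ^ 2 - (C.hess).2.1 * γ 1 0 * γ 1 1 + (C.hess).2.2 * γ 1 1 ^ 2)) := by
  simp only [hess, subst, Matrix.det_fin_two, Prod.mk.injEq]
  refine ⟨?_, ?_, ?_⟩ <;> ring

/-! ### The cubic covariant `g` and the identities behind HCL I, Thm 13 -/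

/-- The **cubic covariant** `g = (g₀, g₁, g₂, g₃)` of `C`: `g₀ = 2a₁³ − 3a₀a₁a₂ + a₀²a₃`,
`g₁ = a₁²a₂ − 2a₀a₂² + a₀a₁a₃`, `g₂ = −(a₁a₂² − 2a₁²a₃ + a₀a₂a₃)`, `g₃ = −(2a₂³ − 3a₁a₂a₃ + a₀a₃²)`
— twice Bhargava's `cᵢ` at `ε = 0` (HCL I, proof of Thm 13: `c₀ = ½(2a₁³ − 3a₀a₁a₂ + a₀²a₃ − εa₀)`,
…; Bhargava–Varma (6) for `c₁ = e₁`, `c₂ = e₂`), so that `cᵢ + aᵢτ = (gᵢ + aᵢ√D)/2` for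
`τ = (ε + √D)/2`. Packaged as an integer-matrix form (it is one: a covariant of the same type as
`C`, `gCov_subst`). [cite: Bhargava2004HCL1, §3.4 (proof of Theorem 13, the solution c₀,…,c₃)] -/
def gCov (C : SymCubic R) : SymCubic R :=
  ⟨2 * C.a₁ ^ 3 - 3 * C.a₀ * C.a₁ * C.a₂ + C.a₀ ^ 2 * C.a₃,
    C.a₁ ^ 2 * C.a₂ - 2 * C.a₀ * C.a₂ ^ 2 + C.a₀ * C.a₁ * C.a₃,
    -(C.a₁ * C.a₂ ^ 2 - 2 * C.a₁ ^ 2 * C.a₃ + C.a₀ * C.a₂ * C.a₃),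
    -(2 * C.a₂ ^ 3 - 3 * C.a₁ * C.a₂ * C.a₃ + C.a₀ * C.a₃ ^ 2)⟩

/-- **Syzygy `(0,2)`**: `g₀g₂ − g₁² = D · A` (`D = disc C`, `A = a₁² − a₀a₂`) — the `√D`-free part of
`θ₀θ₂ = θ₁²` for `θᵢ = gᵢ + aᵢ√D`, i.e. of "`(α²β)² = α³ · αβ²`" in HCL I, proof of Thm 13.
[cite: Bhargava2004HCL1, §3.4 (proof of Theorem 13: (α²β)² = α³·αβ²)] -/
theorem gCov_syzygy₀₂ (C : SymCubic R) :
    (C.gCov).a₀ * (C.gCov).a₂ - (C.gCov).a₁ ^ 2 = C.disc * (C.hess).1 := by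
  simp only [gCov, disc, hess]
  ring

/-- **Syzygy `(1,3)`**: `g₁g₃ − g₂² = D · C` (`C = a₂² − a₁a₃`) — the `√D`-free part of
`θ₁θ₃ = θ₂²`, i.e. of "`(αβ²)² = α²β · β³`". [cite: Bhargava2004HCL1, §3.4 (proof of Theorem 13: (αβ²)² = α²β·β³)] -/
theorem gCov_syzygy₁₃ (C : SymCubic R) :
    (C.gCov).a₁ * (C.gCov).a₃ - (C.gCov).a₂ ^ 2 = C.disc * (C.hess).2.2 := by
  simp only [gCov, disc, hess]
  ring

/-- **Syzygy `(0,3)`**: `g₀g₃ − g₁g₂ = −D · B` (`B = a₀a₃ − a₁a₂`) — the `√D`-free part of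
`θ₀θ₃ = θ₁θ₂` ("`α³ · β³ = α²β · αβ²`"). [folklore] -/
theorem gCov_syzygy₀₃ (C : SymCubic R) :
    (C.gCov).a₀ * (C.gCov).a₃ - (C.gCov).a₁ * (C.gCov).a₂ = -(C.disc * (C.hess).2.1) := by
  simp only [gCov, disc, hess]
  ring

/-- The `√D`-part of `θ₀θ₂ = θ₁²`: `a₀g₂ + a₂g₀ = 2a₁g₁`. [cite: Bhargava2004HCL1, §3.4 (proof of Theorem 13, the two linear equations)] -/
theorem gCov_linear₀₂ (C : SymCubic R) :
    C.a₀ * (C.gCov).a₂ + C.a₂ * (C.gCov).a₀ = 2 * C.a₁ * (C.gCov).a₁ := by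
  simp only [gCov]
  ring

/-- The `√D`-part of `θ₁θ₃ = θ₂²`: `a₁g₃ + a₃g₁ = 2a₂g₂`. [cite: Bhargava2004HCL1, §3.4 (proof of Theorem 13, the two linear equations)] -/
theorem gCov_linear₁₃ (C : SymCubic R) :
    C.a₁ * (C.gCov).a₃ + C.a₃ * (C.gCov).a₁ = 2 * C.a₂ * (C.gCov).a₂ := by
  simp only [gCov]
  ring

/-- The `√D`-part of `θ₀θ₃ = θ₁θ₂`: `a₀g₃ + a₃g₀ = a₁g₂ + a₂g₁`. [folklore] -/
theorem gCov_linear₀₃ (C : SymCubic R) :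
    C.a₀ * (C.gCov).a₃ + C.a₃ * (C.gCov).a₀ = C.a₁ * (C.gCov).a₂ + C.a₂ * (C.gCov).a₁ := by
  simp only [gCov]
  ring

/-- `disc` of the cubic covariant: `disc(g) = D³` (`g` is again of discriminant a cube; classical).
[folklore] -/
theorem disc_gCov (C : SymCubic R) : (C.gCov).disc = C.disc ^ 3 := by
  simp only [gCov, disc]
  ring

/-- **`g` is a covariant of weight `3`**: `g(C ∘ γ) = (det γ)³ · g(C) ∘ γ`; in particular
`g(C ∘ γ) = g(C) ∘ γ` for `γ ∈ SL₂`, so that `θ = g + a√D` transforms like `C` itself (HCL I,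
proof of Thm 13: "changing `α, β` … via `T ∈ SL₂(ℤ)` simply changes `C(x, y)` by that same
element"). [folklore] -/
theorem gCov_subst (C : SymCubic R) (γ : Matrix (Fin 2) (Fin 2) R) :
    (C.subst γ).gCov = γ.det ^ 3 • (C.gCov).subst γ := by
  ext <;> simp only [gCov, subst, smul_a₀, smul_a₁, smul_a₂, smul_a₃, Matrix.det_fin_two] <;> ring

/-! ### Parity: Bhargava's `cᵢ = (gᵢ − εaᵢ)/2` are integers -/

/-- The parity computation behind the integrality of Bhargava's `cᵢ`, over `ZMod 2`:
`gᵢ + D aᵢ = 0` identically (a finite check over the `16` residues of `(a₀, a₁, a₂, a₃)`). [folklore] -/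
theorem gCov_add_disc_smul_eq_zero_zmod_two (C : SymCubic (ZMod 2)) :
    C.gCov.a₀ + C.disc * C.a₀ = 0 ∧ C.gCov.a₁ + C.disc * C.a₁ = 0 ∧
      C.gCov.a₂ + C.disc * C.a₂ = 0 ∧ C.gCov.a₃ + C.disc * C.a₃ = 0 := by
  obtain ⟨a₀, a₁, a₂, a₃⟩ := C
  simp only [gCov, disc]
  revert a₀ a₁ a₂ a₃
  decide

/-- `map` of an integer-matrix form along a ring homomorphism (here: reduction mod `2`). [folklore] -/
def map {S : Type*} [CommRing S] (φ : R →+* S) (C : SymCubic R) : SymCubic S :=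
  ⟨φ C.a₀, φ C.a₁, φ C.a₂, φ C.a₃⟩

/-- `map` commutes with `gCov`. [folklore] -/
theorem gCov_map {S : Type*} [CommRing S] (φ : R →+* S) (C : SymCubic R) :
    (C.map φ).gCov = C.gCov.map φ := by
  ext <;> simp only [map, gCov, map_sub, map_add, map_mul, map_pow, map_neg, map_ofNat]

/-- `map` commutes with `disc`. [folklore] -/
theorem disc_map {S : Type*} [CommRing S] (φ : R →+* S) (C : SymCubic R) :
    (C.map φ).disc = φ C.disc := by
  simp only [map, disc, map_sub, map_add, map_mul, map_pow, map_ofNat]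

/-- **Integrality of Bhargava's `cᵢ`**: `gᵢ ≡ D·aᵢ (mod 2)` for every integral `C`, `D = disc C`
(and `D ≡ ε (mod 2)`), so `cᵢ = (gᵢ − εaᵢ)/2 ∈ ℤ` — "the solutions for the `{cᵢ}` are necessarily
integral" (HCL I, proof of Thm 13). [cite: Bhargava2004HCL1, §3.4 (proof of Theorem 13, integrality of the cᵢ)] -/
theorem two_dvd_gCov_add_disc_mul (C : SymCubic ℤ) :
    (2 : ℤ) ∣ C.gCov.a₀ + C.disc * C.a₀ ∧ (2 : ℤ) ∣ C.gCov.a₁ + C.disc * C.a₁ ∧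
      (2 : ℤ) ∣ C.gCov.a₂ + C.disc * C.a₂ ∧ (2 : ℤ) ∣ C.gCov.a₃ + C.disc * C.a₃ := by
  have h := gCov_add_disc_smul_eq_zero_zmod_two (C.map (Int.castRingHom (ZMod 2)))
  rw [gCov_map, disc_map] at h
  simp only [map, Int.coe_castRingHom] at h
  obtain ⟨h0, h1, h2, h3⟩ := h
  refine ⟨?_, ?_, ?_, ?_⟩
  · exact_mod_cast (ZMod.intCast_zmod_eq_zero_iff_dvd _ 2).1 (by push_cast; exact h0)
  · exact_mod_cast (ZMod.intCast_zmod_eq_zero_iff_dvd _ 2).1 (by push_cast; exact h1)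
  · exact_mod_cast (ZMod.intCast_zmod_eq_zero_iff_dvd _ 2).1 (by push_cast; exact h2)
  · exact_mod_cast (ZMod.intCast_zmod_eq_zero_iff_dvd _ 2).1 (by push_cast; exact h3)

end SymCubic

end Literature.NumberTheory.CubicFields
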